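/-
Copyright: width seat `ym-line-sll-p4` (prover-ym-line-sll-p4-g0-0), route `SoftLoopLongLag`, cruxes K′ `SoftLoopLagFloorToTorus`
(stmt-QuantumFields-22504) / T′ `ColdBoxSoftLoopLagFloor` (stmt-QuantumFields-24180), line `birth` — engine layer «loop mean core with datum»
of N2-loops (the one-scale kernel mean expansion of ONE `R×T` loop), the hypothesis of the landed E2 reduction
`innerDatumMeanSmoothG_of_loopMeanExpansion` (`…InnerMeanSmoothOfExpansionG`).
-/
import Summits.QuantumFields.YangMills.Theorems.SoftLoopLongLagLoopCostChart
import Summits.QuantumFields.YangMills.Theorems.SoftLoopLongLagDirichletLoopInductance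
import Summits.QuantumFields.YangMills.Theorems.ColdBoxAllGroupsBulkAllGroupsKernelMeanDatumCoreG
import Summits.QuantumFields.YangMills.Theorems.ColdBoxAllGroupsBulkAllGroupsKernelMeanTrunkG
import Literature.MathematicalPhysics.QuantumFieldTheory.Balaban1983to89.ClassLoopObservablesNotDenseSO8
import Literature.RepresentationTheory.CompactGroups.UnitaryTrick

/-!
# Route `SoftLoopLongLag`, line `birth` (both cruxes), engine layer N2-loops: the one-scale expansion of the kernel MEAN of an `R×T` Wilson
# LOOP with datum, ASSEMBLED at fixed `β` — the deterministic loop mean core, every compact group presented in `U(N)`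

Loop twin of the sibling's plaquette core `abs_kernelMeanG_sub_gaussian_le_datum` (`Theorems/ColdBoxAllGroupsBulkAllGroupsKernelMeanDatumCoreG.lean`,
crux `BulkAllGroups`, whose N2-G `stub_kernelMeanExpansionG` is landed).  For the DLR box kernel `γ(·|W) = boxKernelG ρ β H W` of a faithful
continuous unitary `ρ : G →* U(N)` (`D = dimE ρ` colours) with an exterior datum in chart form off the cold box `Λ = boxEdges 4 (2H+1)`
(`W e = expChart ρ (datVec ϑ e)`, `Σ_c ϑ_{c,e}² ≤ r²` off `Λ`, `ϑ = 0` on the temporal forest, `r ≤ m ≤ 1/4`), for an `R×T` rectangle `ℓ = rectWalk x 1 2 R T`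
whose spanning surface `S = rectSurface x R T` consists of plaquettes touching `Λ` and with `2(R+T)·m ≤ 1/4`, given the T3 inputs (`hball`, chart
density `c·g`, YM bad mass `pY < 1`), the REAL inputs on the Gaussian window `S_t = goodTDE ∩ {‖unscaleTE (t + μ') e‖ ≤ m}` (tilt bound `w`, bad mass
`P ≤ 1/2`), and TWO Gaussian facts about the LOOP quadratic surrogate
`Q(t) = ½Σ_c (F'_c + X_S(t_c))²`, `F'_c = Σ_{p∈S} sCirc(glue ϑ'_c (mean ϑ'_c)) p` (scaled background FLUX, `ϑ' = sdatE β ϑ`), `X_S(s) = Σ_{p∈S} dirCirc H p s`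
(surface sum) — namely `Q ∈ L²(gaussD H D)` and `∫ Q² d(gaussD) ≤ B` (the loop Gaussian bookkeeping, seat `ym-line-sll-p5`'s layer) —
**`abs_kernelMeanG_loopCost_sub_gaussMean_le_datum`**:

  `|β·E_{γ(·|W)}[N − Re tr ρ(hol_ℓ)] − ∫ Q d(gaussD H D)| ≤ 2(2Nβ)·pY + M_ℓ(e^{2w} − 1) + τ_ℓ + 2(1 + B)·√P`,

`τ_ℓ = 9β(2(R+T)m)³` (R3-loop with datum, `abs_beta_mul_loopCost_sub_loopSurrogate_le`, `…LoopCostChart`), `M_ℓ = β(8D(RTm)² + 9(2(R+T)m)³)` (on-window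
bound of the loop cost through its surrogate).  Chain (as the sibling): T3′ `integral_cond_boxKernelG_eq_integral_tilted_datum'` (observable-generic; the loop
cost is measurable, gauge invariant — `isZdGaugeInvariant_comp_walkHolonomy` — and `≥ 0`), YM conditioning `abs_integral_sub_integral_cond_le` (global
bound `2Nβ`, `abs_re_trace_le_card`), Gaussian bookkeeping `abs_mean_tilted_cond_sub_le`.  The Gaussian value `∫ Q = (D/2)·V_S + ½Σ_c F'_c²`,
`V_S = Σ_{p,q∈S} boxDirProjKernel H p q`, is substituted by the assembler (loop Wick layer), giving the N2-loops interface of the E2 reduction.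

No sorry; no new definition; standard axioms.  HONEST LABEL: rung R2xi-G RECORD label (leaf `WeakCouplingRates.XiPow`, an UPPER bound on the lattice
mass gap); NOT the Clay mass gap; no summit statement is touched.

References: T. Balaban, CMP 89 (1983) §2; S. Chatterjee, arXiv:1602.01222 §§11–13; the tree's `SU(2)` trunk
`WeakCouplingRatesBulkDominatesColdBoxWKernelMeanTrunk`.
-/

set_option autoImplicit false

noncomputable section

open MeasureTheory ProbabilityTheory Finset Metric
open scoped ENNReal Matrix.Norms.Frobenius
open Literature.Probability.LatticeModels (Site zdGraph)
open Literature.MathematicalPhysics.QuantumLattice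
open Literature.MathematicalPhysics.QuantumFieldTheory
open Literature.MathematicalPhysics.QuantumFieldTheory.LatticeMaxwell
open Literature.MathematicalPhysics.QuantumFieldTheory.AxialGauge
open Summit.QuantumFields.YangMills.Theorems.WeakCouplingRates
open Summit.QuantumFields.YangMills.Theorems.FreeEnergyLogCoefficient
open Summit.QuantumFields.YangMills.Theorems.ColdBoxAllGroups

namespace Summit.QuantumFields.YangMills.Theorems.SoftLoopLongLag

variable {H : ℕ} {N : ℕ} {G : Type} [Group G] (ρ : G →* Matrix (Fin N) (Fin N) ℂ)

/-! ## §1 The loop cost observable: invariance, sign, size, measurability -/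

section Observable

variable [TopologicalSpace G] [IsTopologicalGroup G] [CompactSpace G] [MeasurableSpace G] [BorelSpace G]

omit [TopologicalSpace G] [IsTopologicalGroup G] [CompactSpace G] [MeasurableSpace G] [BorelSpace G] in
/-- The loop cost `N − Re tr ρ(hol_w)` of a based loop is gauge invariant (class function of the holonomy: cyclicity of the trace). -/
theorem isZdGaugeInvariant_loopCost (β : ℝ) {x : Site 4} (w : (zdGraph 4).Walk x x) :
    IsZdGaugeInvariant fun U : LGConfig 4 G => β * ((N : ℝ) - (ρ (walkHolonomy U w)).trace.re) := by
  refine Literature.MathematicalPhysics.QuantumFieldTheory.Balaban1983to89.ClassLoopObservablesNotDenseSO8.isZdGaugeInvariant_comp_walkHolonomy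
    (f := fun g : G => β * ((N : ℝ) - (ρ g).trace.re)) (fun a b => ?_) w
  have : (ρ (b * a * b⁻¹)).trace = (ρ a).trace := by
    rw [map_mul, map_mul, Matrix.trace_mul_comm, ← Matrix.mul_assoc, ← map_mul, ← map_mul, inv_mul_cancel, one_mul]
  simp only [this]

omit [TopologicalSpace G] [IsTopologicalGroup G] [CompactSpace G] [MeasurableSpace G] [BorelSpace G] in
/-- The loop cost is nonnegative for a unitary-valued `ρ` (`N − Re tr U = ½‖U − 1‖_F²`). -/
theorem sub_re_trace_walkHolonomy_nonneg (hρu : ∀ g, ρ g ∈ Matrix.unitaryGroup (Fin N) ℂ) {x : Site 4} (w : (zdGraph 4).Walk x x) (U : LGConfig 4 G) :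
    0 ≤ (N : ℝ) - (ρ (walkHolonomy U w)).trace.re := by
  rw [Literature.MathematicalPhysics.QuantumFieldTheory.sub_re_trace_eq_half_norm_sub_one_sq (hρu _)]
  positivity

omit [MeasurableSpace G] [BorelSpace G] in
/-- The loop cost is at most `2N` in absolute value (`|Re tr ρ g| ≤ N`). -/
theorem abs_loopCost_le (hρc : Continuous ρ) {x : Site 4} (w : (zdGraph 4).Walk x x) (U : LGConfig 4 G) :
    |(N : ℝ) - (ρ (walkHolonomy U w)).trace.re| ≤ 2 * N := by
  have h := Literature.RepresentationTheory.CompactGroups.CompactGroup.abs_re_trace_le_card ρ hρc (walkHolonomy U w)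
  rw [Fintype.card_fin] at h
  have h1 := abs_sub (N : ℝ) (ρ (walkHolonomy U w)).trace.re
  rw [Nat.abs_cast] at h1
  linarith

omit [CompactSpace G] in
/-- The loop cost is measurable (continuous) in the configuration. -/
theorem measurable_loopCost [SecondCountableTopology G] (hρc : Continuous ρ) (β : ℝ) {x : Site 4} (w : (zdGraph 4).Walk x x) :
    Measurable fun U : LGConfig 4 G => β * ((N : ℝ) - (ρ (walkHolonomy U w)).trace.re) := by
  have hχ : Continuous fun g : G => β * ((N : ℝ) - (ρ g).trace.re) := by fun_prop
  exact (hχ.comp (continuous_walkHolonomy w)).measurable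

end Observable

/-! ## §2 Fluxes of bounded coordinates -/

/-- A surface flux of edge coordinates of norm `≤ m` is at most `R·T·(4m)` in absolute value, colour by colour. -/
theorem abs_sum_sCirc_apply_le (a : Literature.MathematicalPhysics.QuantumLattice.ZdEdge 4 → EuclideanSpace ℝ (Fin (dimE ρ))) {m : ℝ}
    (ha : ∀ e, ‖a e‖ ≤ m) (x : Site 4) (R T : ℕ) (c : Fin (dimE ρ)) :
    |∑ p ∈ rectSurface x R T, sCirc (fun e => a e c) ((p.1, p.2.1.1, p.2.1.2) : Plaq 4)| ≤ (R : ℝ) * T * (4 * m) := by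
  have hac : ∀ e, |a e c| ≤ m := fun e => (Real.norm_eq_abs _ ▸ PiLp.norm_apply_le (a e) c).trans (ha e)
  have hterm : ∀ p ∈ rectSurface x R T, |sCirc (fun e => a e c) ((p.1, p.2.1.1, p.2.1.2) : Plaq 4)| ≤ 4 * m := by
    intro p _
    simp only [sCirc]
    have h1 := hac (p.1, p.2.1.1)
    have h2 := hac (p.1 + Pi.single p.2.1.1 1, p.2.1.2)
    have h3 := hac (p.1 + Pi.single p.2.1.2 1, p.2.1.1)
    have h4 := hac (p.1, p.2.1.2)
    rw [abs_le] at h1 h2 h3 h4 ⊢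
    constructor <;> linarith
  refine (Finset.abs_sum_le_sum_abs _ _).trans ((Finset.sum_le_card_nsmul _ _ _ hterm).trans ?_)
  rw [nsmul_eq_mul]
  have hm0 : 0 ≤ 4 * m := by linarith [(abs_nonneg _).trans (hac ((x, 1) : Literature.MathematicalPhysics.QuantumLattice.ZdEdge 4))]
  have hcard : ((rectSurface x R T).card : ℝ) ≤ (R : ℝ) * T := by exact_mod_cast card_rectSurface_le x R T
  exact mul_le_mul_of_nonneg_right hcard hm0

/-! ## §3 The loop mean core with datum -/

section Core

variable [TopologicalSpace G] [IsTopologicalGroup G] [CompactSpace G] [MeasurableSpace G] [BorelSpace G] [SecondCountableTopology G]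

set_option maxHeartbeats 400000 in
/-- **The one-scale expansion of the kernel mean of an `R×T` LOOP with datum, assembled at fixed `β` (deterministic loop mean core), every
compact group presented in `U(N)`.**  See the module docstring.  The Gaussian side enters only through `hQ2` (`Q ∈ L²`) and `hQsq` (`∫Q² ≤ B`);
the conclusion compares with `∫ Q d(gaussD H D)`, which the loop Wick layer evaluates to `(D/2)·V_S + ½Σ_c F'_c²`. [folklore] -/
theorem abs_kernelMeanG_loopCost_sub_gaussMean_le_datum (hρc : Continuous ρ) (hinj : Function.Injective ρ)
    (hρu : ∀ g, ρ g ∈ Matrix.unitaryGroup (Fin N) ℂ) {β ε r m w P pY B : ℝ}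
    {g : EuclideanSpace ℝ (Fin (dimE ρ)) → ℝ} (hgm : Measurable g)
    (hβ : 1 ≤ β) (hH : 1 ≤ H) (hr : 0 ≤ r) (hrm : r ≤ m) (hm4 : m ≤ 1 / 4)
    {W : LGConfig 4 G} {ϑ : Fin (dimE ρ) → (Literature.MathematicalPhysics.QuantumLattice.ZdEdge 4 → ℝ)}
    (hW : ∀ e, e ∉ AxialGauge.boxEdges 4 (2 * H + 1) → W e = expChart ρ (datVec ϑ e))
    (hϑ : ∀ e, e ∉ AxialGauge.boxEdges 4 (2 * H + 1) → ∑ c, ϑ c e ^ 2 ≤ r ^ 2)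
    (hforest : ∀ y : Site 4, (∀ k : Fin 4, 1 ≤ y k ∧ y k + 1 ≤ 2 * (H : ℤ)) → ∀ c, ϑ c (y, 0) = 0)
    (hball : ∀ u : G, ‖ρ u - 1‖ ≤ (12 * (H : ℝ) ^ 2 + 2 * H + 1) * (Real.sqrt 2 * Real.sqrt (β ^ (2 * ε - 1)) + 8 * r) →
      u ∈ expChart ρ '' closedBall (0 : EuclideanSpace ℝ (Fin (dimE ρ))) m)
    (hgpos : ∀ a, ‖a‖ ≤ m → 0 < g a) {c : ℝ≥0∞} (hc0 : c ≠ 0) (hctop : c ≠ ∞)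
    (hdens : (chartMeasureE ρ (1 / 4)).restrict (closedBall 0 m) =
      (c • (volume : Measure (EuclideanSpace ℝ (Fin (dimE ρ)))).restrict (closedBall 0 m)).withDensity
        (fun a => ENNReal.ofReal (g a)))
    (hpY : (boxKernelG ρ β H W).real (coldGoodSetG ρ H β ε)ᶜ ≤ pY) (hpY1 : pY < 1)
    (hP : (gaussD H (dimE ρ)).real
        (goodTDE ρ H β ε ϑ ∩ {t | ∀ e, ‖unscaleTE H (dimE ρ) β (t + meanTE H (dimE ρ) β ϑ) e‖ ≤ m})ᶜ ≤ P) (hP2 : P ≤ 1 / 2)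
    (hWb : ∀ t ∈ goodTDE ρ H β ε ϑ ∩ {t | ∀ e, ‖unscaleTE H (dimE ρ) β (t + meanTE H (dimE ρ) β ϑ) e‖ ≤ m},
      |tiltWDE ρ H g β ϑ t| ≤ w)
    -- the loop
    (x : Site 4) (R T : ℕ) (hRT : 2 * ((R : ℝ) + T) * m ≤ 1 / 4)
    (hS : ∀ p ∈ rectSurface x R T, p ∈ plaquettesTouching (AxialGauge.boxEdges 4 (2 * H + 1)))
    -- the loop Gaussian bookkeeping (loop Wick layer), as hypotheses
    (hQ2 : MemLp (fun t : TSpaceD H (dimE ρ) => (1 / 2 : ℝ) * ∑ c, ((∑ p ∈ rectSurface x R T,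
        sCirc (glue (pin := fun e => e ∉ dirFreeEdges H) dirCorner (2 * H + 3) (sdatE β ϑ c)
          (mean (fun e => e ∉ dirFreeEdges H) dirCorner (2 * H + 3) (sdatE β ϑ c))) ((p.1, p.2.1.1, p.2.1.2) : Plaq 4)) +
        ∑ p ∈ rectSurface x R T, dirCirc H ((p.1, p.2.1.1, p.2.1.2) : Plaq 4) (t c)) ^ 2) 2 (gaussD H (dimE ρ)))
    (hQsq : ∫ t, ((1 / 2 : ℝ) * ∑ c, ((∑ p ∈ rectSurface x R T,
        sCirc (glue (pin := fun e => e ∉ dirFreeEdges H) dirCorner (2 * H + 3) (sdatE β ϑ c)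
          (mean (fun e => e ∉ dirFreeEdges H) dirCorner (2 * H + 3) (sdatE β ϑ c))) ((p.1, p.2.1.1, p.2.1.2) : Plaq 4)) +
        ∑ p ∈ rectSurface x R T, dirCirc H ((p.1, p.2.1.1, p.2.1.2) : Plaq 4) (t c)) ^ 2) ^ 2 ∂(gaussD H (dimE ρ)) ≤ B) :
    |β * (∫ U, ((N : ℝ) - (ρ (walkHolonomy U (rectWalk x 1 2 R T))).trace.re) ∂(boxKernelG ρ β H W)) -
        ∫ t, ((1 / 2 : ℝ) * ∑ c, ((∑ p ∈ rectSurface x R T,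
          sCirc (glue (pin := fun e => e ∉ dirFreeEdges H) dirCorner (2 * H + 3) (sdatE β ϑ c)
            (mean (fun e => e ∉ dirFreeEdges H) dirCorner (2 * H + 3) (sdatE β ϑ c))) ((p.1, p.2.1.1, p.2.1.2) : Plaq 4)) +
          ∑ p ∈ rectSurface x R T, dirCirc H ((p.1, p.2.1.1, p.2.1.2) : Plaq 4) (t c)) ^ 2) ∂(gaussD H (dimE ρ))| ≤
      2 * (2 * N * β) * pY +
        (β * (8 * (dimE ρ : ℝ) * ((R : ℝ) * T * m) ^ 2 + 9 * (2 * ((R : ℝ) + T) * m) ^ 3) * (Real.exp (2 * w) - 1) +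
          9 * β * (2 * ((R : ℝ) + T) * m) ^ 3 + 2 * (1 + B) * Real.sqrt P) := by
  have hβ0 : 0 < β := by linarith
  -- abbreviations
  set μ := boxKernelG ρ β H W with hμ
  set Gd := coldGoodSetG ρ H β ε with hGd
  set γ : Measure (TSpaceD H (dimE ρ)) := gaussD H (dimE ρ) with hγ
  set S : Set (TSpaceD H (dimE ρ)) := goodTDE ρ H β ε ϑ ∩
    {t | ∀ e, ‖unscaleTE H (dimE ρ) β (t + meanTE H (dimE ρ) β ϑ) e‖ ≤ m} with hSdef
  obtain ⟨f, hf⟩ : ∃ f : LGConfig 4 G → ℝ, ∀ U, f U = β * ((N : ℝ) - (ρ (walkHolonomy U (rectWalk x 1 2 R T))).trace.re) :=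
    ⟨_, fun _ => rfl⟩
  obtain ⟨F, hF⟩ : ∃ F : Fin (dimE ρ) → ℝ, ∀ cc, F cc = ∑ p ∈ rectSurface x R T,
      sCirc (glue (pin := fun e => e ∉ dirFreeEdges H) dirCorner (2 * H + 3) (sdatE β ϑ cc)
        (mean (fun e => e ∉ dirFreeEdges H) dirCorner (2 * H + 3) (sdatE β ϑ cc))) ((p.1, p.2.1.1, p.2.1.2) : Plaq 4) := ⟨_, fun _ => rfl⟩
  obtain ⟨Q, hQ⟩ : ∃ Q : TSpaceD H (dimE ρ) → ℝ, ∀ t, Q t = (1 / 2 : ℝ) * ∑ cc, (F cc +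
      ∑ p ∈ rectSurface x R T, dirCirc H ((p.1, p.2.1.1, p.2.1.2) : Plaq 4) (t cc)) ^ 2 := ⟨_, fun _ => rfl⟩
  have hfeq : (fun U : LGConfig 4 G => β * ((N : ℝ) - (ρ (walkHolonomy U (rectWalk x 1 2 R T))).trace.re)) = f :=
    funext fun U => (hf U).symm
  have hQeq : (fun t : TSpaceD H (dimE ρ) => (1 / 2 : ℝ) * ∑ c, ((∑ p ∈ rectSurface x R T,
      sCirc (glue (pin := fun e => e ∉ dirFreeEdges H) dirCorner (2 * H + 3) (sdatE β ϑ c)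
        (mean (fun e => e ∉ dirFreeEdges H) dirCorner (2 * H + 3) (sdatE β ϑ c))) ((p.1, p.2.1.1, p.2.1.2) : Plaq 4)) +
      ∑ p ∈ rectSurface x R T, dirCirc H ((p.1, p.2.1.1, p.2.1.2) : Plaq 4) (t c)) ^ 2) = Q := by
    funext t; rw [hQ]; simp_rw [hF]
  have hQ2' : MemLp Q 2 γ := by rw [← hQeq]; exact hQ2
  have hQsq' : ∫ t, Q t ^ 2 ∂γ ≤ B := by
    have hfun : (fun t : TSpaceD H (dimE ρ) => Q t ^ 2) = fun t => ((1 / 2 : ℝ) * ∑ c, ((∑ p ∈ rectSurface x R T,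
        sCirc (glue (pin := fun e => e ∉ dirFreeEdges H) dirCorner (2 * H + 3) (sdatE β ϑ c)
          (mean (fun e => e ∉ dirFreeEdges H) dirCorner (2 * H + 3) (sdatE β ϑ c))) ((p.1, p.2.1.1, p.2.1.2) : Plaq 4)) +
        ∑ p ∈ rectSurface x R T, dirCirc H ((p.1, p.2.1.1, p.2.1.2) : Plaq 4) (t c)) ^ 2) ^ 2 := by
      funext t; rw [← hQeq]
    rw [hfun]; exact hQsq
  rw [← integral_const_mul, hfeq, hQeq]
  set M₀ : ℝ := 2 * N * β with hM₀
  set M : ℝ := β * (8 * (dimE ρ : ℝ) * ((R : ℝ) * T * m) ^ 2 + 9 * (2 * ((R : ℝ) + T) * m) ^ 3) with hMdef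
  set τ : ℝ := 9 * β * (2 * ((R : ℝ) + T) * m) ^ 3 with hτ
  have hm0 : 0 ≤ m := hr.trans hrm
  have hRTm0 : 0 ≤ 2 * ((R : ℝ) + T) * m := by positivity
  have hM0 : 0 ≤ M := by positivity
  -- the two charged events
  have hGm : MeasurableSet Gd := measurableSet_coldGoodSetG ρ hρc β ε
  have hSm : MeasurableSet S :=
    (measurableSet_goodTDE ρ hρc hinj β ε ϑ).inter (measurableSet_ball_unscaleTE_add (dimE ρ) β m _)
  haveI : IsProbabilityMeasure μ := isProbabilityMeasure_boxKernelG ρ hρc β H W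
  haveI : IsProbabilityMeasure γ := isProbabilityMeasure_gaussD H (dimE ρ)
  have hG0 : μ Gd ≠ 0 := measure_ne_zero_of_real_compl_lt_one μ hGm (hpY.trans_lt hpY1)
  have hS0 : γ S ≠ 0 := measure_ne_zero_of_real_compl_lt_one γ hSm (hP.trans_lt (by linarith))
  -- the observable
  have hXm : Measurable f := by rw [← hfeq]; exact measurable_loopCost ρ hρc β _
  have hXinv : IsZdGaugeInvariant f := by rw [← hfeq]; exact isZdGaugeInvariant_loopCost ρ β _
  have hX0 : ∀ U, 0 ≤ f U := fun U => by rw [hf]; exact mul_nonneg hβ0.le (sub_re_trace_walkHolonomy_nonneg ρ hρu _ U)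
  have hfM : ∀ U, |f U| ≤ M₀ := fun U => by
    rw [hf, abs_mul, abs_of_pos hβ0, hM₀]
    nlinarith [abs_loopCost_le ρ hρc (rectWalk x 1 2 R T) U, abs_nonneg ((N : ℝ) - (ρ (walkHolonomy U (rectWalk x 1 2 R T))).trace.re)]
  have hfi : Integrable f μ := integrable_of_abs_le hXm.aestronglyMeasurable hfM
  -- T3′: the representation (observable-generic)
  have hϑ' : ∀ e, e ∉ AxialGauge.boxEdges 4 (2 * H + 1) → ‖datVec ϑ e‖ ≤ r := fun e he => norm_datVec_le ϑ hr (hϑ e he)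
  have hRep : ∫ U, f U ∂(μ[|Gd]) = ∫ t, f (cfgTDE ρ H β ϑ t) ∂((γ[|S]).tilted (S.indicator (tiltWDE ρ H g β ϑ))) :=
    integral_cond_boxKernelG_eq_integral_tilted_datum' ρ hρc hinj hρu hβ0 hH hr hm4 hball hW hϑ' hgm hgpos hc0 hctop hdens hG0 hS0
      hXm hXinv hX0
  -- (1) YM conditioning
  have h1 : |(∫ U, f U ∂μ) - ∫ U, f U ∂(μ[|Gd])| ≤ 2 * M₀ * pY := by
    have key := abs_integral_sub_integral_cond_le (μ := μ) hGm hG0 hfi hfM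
    have hM₀0 : 0 ≤ 2 * M₀ := by rw [hM₀]; positivity
    exact key.trans (mul_le_mul_of_nonneg_left hpY hM₀0)
  -- the tilt bound (indicator form)
  have hw0 : 0 ≤ w := by
    by_cases hne : S.Nonempty
    · obtain ⟨t, ht⟩ := hne; exact (abs_nonneg _).trans (hWb t ht)
    · exfalso; apply hS0; rw [Set.not_nonempty_iff_eq_empty.1 hne, measure_empty]
  have hWt : ∀ t, |S.indicator (tiltWDE ρ H g β ϑ) t| ≤ w := by
    intro t
    by_cases ht : t ∈ S
    · rw [Set.indicator_of_mem ht]; exact hWb t ht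
    · rw [Set.indicator_of_notMem ht, abs_zero]; exact hw0
  -- on the window: every chart coordinate of `cfgTDE t` is `≤ m`
  have hcoord : ∀ t ∈ S, ∀ e, ‖extDatum (datVec ϑ) (unscaleTE H (dimE ρ) β (t + meanTE H (dimE ρ) β ϑ)) e‖ ≤ m :=
    fun t ht e => norm_extDatum_le_of_window ρ ϑ _ hr hrm hϑ ht.2 e
  -- (R3-loop) the surrogate on the window, and its identification with `Q`
  have hQsur : ∀ t, Q t = (1 / 2 : ℝ) * ∑ cc, (∑ p ∈ rectSurface x R T,
      sCirc (glue (pin := fun e => e ∉ dirFreeEdges H) dirCorner (2 * H + 3) (sdatE β ϑ cc)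
        (mean (fun e => e ∉ dirFreeEdges H) dirCorner (2 * H + 3) (sdatE β ϑ cc) + WithLp.ofLp (t cc)))
        ((p.1, p.2.1.1, p.2.1.2) : Plaq 4)) ^ 2 := by
    intro t
    rw [hQ]
    congr 1
    refine Finset.sum_congr rfl fun cc _ => ?_
    rw [hF, ← Finset.sum_add_distrib]
    congr 1
    exact Finset.sum_congr rfl fun p _ => (sCirc_glue_add_ofLp _ _ _ _).symm
  have hSur : ∀ t ∈ S, |f (cfgTDE ρ H β ϑ t) - Q t| ≤ τ := by
    intro t ht
    rw [hf, hQsur]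
    exact abs_beta_mul_loopCost_sub_loopSurrogate_le ρ hρc hβ0 hforest t (hcoord t ht) x R T hRT hS
  -- on-window bound of the loop cost through the unscaled surrogate
  have hFS : ∀ t ∈ S, |f (cfgTDE ρ H β ϑ t)| ≤ M := by
    intro t ht
    set a := extDatum (datVec ϑ) (unscaleTE H (dimE ρ) β (t + meanTE H (dimE ρ) β ϑ)) with hadef
    have hU : ∀ e, cfgTDE ρ H β ϑ t e = expChart ρ (a e) := fun e => rfl
    have key := abs_loopCost_sub_half_sum_sq_le_of_eq_expChart ρ hρc (cfgTDE ρ H β ϑ t) a hU x R T (hcoord t ht) hRT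
    have hflux : ∀ cc, |∑ p ∈ rectSurface x R T, sCirc (fun e => a e cc) ((p.1, p.2.1.1, p.2.1.2) : Plaq 4)| ≤ (R : ℝ) * T * (4 * m) :=
      fun cc => abs_sum_sCirc_apply_le ρ a (hcoord t ht) x R T cc
    have hsq : ∑ cc, (∑ p ∈ rectSurface x R T, sCirc (fun e => a e cc) ((p.1, p.2.1.1, p.2.1.2) : Plaq 4)) ^ 2 ≤
        (dimE ρ : ℝ) * ((R : ℝ) * T * (4 * m)) ^ 2 := by
      have hterm : ∀ cc ∈ (Finset.univ : Finset (Fin (dimE ρ))),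
          (∑ p ∈ rectSurface x R T, sCirc (fun e => a e cc) ((p.1, p.2.1.1, p.2.1.2) : Plaq 4)) ^ 2 ≤ ((R : ℝ) * T * (4 * m)) ^ 2 := by
        intro cc _
        have h := hflux cc
        rw [← sq_abs]
        exact pow_le_pow_left₀ (abs_nonneg _) h 2
      refine (Finset.sum_le_card_nsmul _ _ _ hterm).trans ?_
      rw [Finset.card_univ, Fintype.card_fin, nsmul_eq_mul]
    have hcost0 : 0 ≤ (N : ℝ) - (ρ (walkHolonomy (cfgTDE ρ H β ϑ t) (rectWalk x 1 2 R T))).trace.re := sub_re_trace_walkHolonomy_nonneg ρ hρu _ _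
    have hcost : (N : ℝ) - (ρ (walkHolonomy (cfgTDE ρ H β ϑ t) (rectWalk x 1 2 R T))).trace.re ≤
        8 * (dimE ρ : ℝ) * ((R : ℝ) * T * m) ^ 2 + 9 * (2 * ((R : ℝ) + T) * m) ^ 3 := by
      rw [abs_le] at key
      have h16 : (1 / 2 : ℝ) * ((dimE ρ : ℝ) * ((R : ℝ) * T * (4 * m)) ^ 2) = 8 * (dimE ρ : ℝ) * ((R : ℝ) * T * m) ^ 2 := by ring
      nlinarith [key.2, hsq]
    rw [hf, abs_mul, abs_of_pos hβ0, abs_of_nonneg hcost0, hMdef]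
    exact mul_le_mul_of_nonneg_left hcost hβ0.le
  -- (2)+(3) representation and Gaussian bookkeeping
  have hFm : Measurable fun t => f (cfgTDE ρ H β ϑ t) := hXm.comp (measurable_cfgTDE ρ hρc hinj β ϑ)
  have h3 := abs_mean_tilted_cond_sub_le (γ := γ) hSm hS0 (measurable_tiltWDE ρ hρc hinj hgm β ϑ) hWt (F := fun t => f (cfgTDE ρ H β ϑ t))
    (Q := Q) hFm hQ2' hM0 hFS hSur hP hP2
  have hsqrt0 : 0 ≤ Real.sqrt P := Real.sqrt_nonneg _
  have h3' : |(∫ t, f (cfgTDE ρ H β ϑ t) ∂((γ[|S]).tilted (S.indicator (tiltWDE ρ H g β ϑ)))) - ∫ t, Q t ∂γ| ≤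
      M * (Real.exp (2 * w) - 1) + τ + 2 * (1 + B) * Real.sqrt P := by
    refine h3.trans ?_
    have : 2 * (1 + ∫ t, Q t ^ 2 ∂γ) * Real.sqrt P ≤ 2 * (1 + B) * Real.sqrt P := by
      apply mul_le_mul_of_nonneg_right _ hsqrt0
      linarith
    linarith
  -- assemble
  rw [hRep] at h1
  calc |(∫ U, f U ∂μ) - ∫ t, Q t ∂γ|
      ≤ |(∫ U, f U ∂μ) - ∫ t, f (cfgTDE ρ H β ϑ t) ∂((γ[|S]).tilted (S.indicator (tiltWDE ρ H g β ϑ)))| +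
          |(∫ t, f (cfgTDE ρ H β ϑ t) ∂((γ[|S]).tilted (S.indicator (tiltWDE ρ H g β ϑ)))) - ∫ t, Q t ∂γ| := abs_sub_le _ _ _
    _ ≤ 2 * M₀ * pY + (M * (Real.exp (2 * w) - 1) + τ + 2 * (1 + B) * Real.sqrt P) := add_le_add h1 h3'

end Core

end Summit.QuantumFields.YangMills.Theorems.SoftLoopLongLag

end
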